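import Summits.HodgeConjecture.CorCM.PairFlipTransportSlots
import Summits.HodgeConjecture.CorCM.PointwiseConjugationSlots
import HarnessLib

/-!
# A common constituent with a compatible pair-flip slot, in EITHER direction, is a relabelling of the slots

COR-CM (cell `pub-hodgecm2`, binder seat `b16` gen 51, count-neutral claim PAIRFLIP-COMPANION, file F1b — abstract
`G`-set level; theorems only, no definition, no named fact, no `sorry`).  NEW as stated, hence under `Summits/`.  HONEST
FRAMING: finite-dimensional linear algebra about families of CM types; `HC_CM` is neither used nor asserted.

Sequel of `PairFlipTransportSlots` (`PairFlipTransport.exists_equivariant_equiv`: an equivariant map injective on the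
odd weights of a slot `X` with PAIR FLIPS COMPATIBLE WITH `Y` — every flip of a pair of `X` fixes the rest of `X` and
maps each `y ∈ Y` to `y` or `ρy` — into the odd weights of `Y`, `|X| = |Y|`, is a relabelling `γ : X ≃ Y`).  The tree's
PAIRWISE CRITERION for rank additivity of a family of CM types (`CMTypeRankCommonConstituent`,
`map_slotExt_antiSpan_le_of_pairwise`; CM fields: `CorCM/PairwiseCMFamiliesHodge`) asks, for each ORDERED pair of slots,
that every `G`-stable `P ≤ U(Φ_i)` carrying an equivariant `T` injective on `P` with `T(P) ≤ U(Φ_j)` be zero.  Here both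
orders are reduced to the transport theorem:

* §1 `exists_inverse_on_map` — bookkeeping valid for any two `G`-sets: an equivariant `T'` injective on a stable
  `P ≤ ℚ^Y` has an INVERSE `S : ℚ^X → ℚ^Y` on `T'(P)`, equivariant and injective there, with values in `P` (built from
  the `G`-invariant dot product: `PointwiseConj.exists_equivariant_proj` onto the stable `T'(P)`, then
  `LinearMap.codRestrictOfInjective`); `comp_smul_mem_map` — `T'(P)` is stable.
* §2 For CM types `Φ_X ⊆ X`, `Φ_Y ⊆ Y` (`IsCMTypeWith ρ`), `X` transitive with pair flips compatible with `Y`, `|X| = |Y|`: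
  **`exists_equivariant_equiv_of_ne_bot`** — a non-zero stable `P ≤ U(Φ_X)` with an equivariant `T`, injective on `P`,
  `T(P) ≤ U(Φ_Y)`, yields a `G`-equivariant bijection `X ≃ Y` (pair flips make `U(Φ_X) = Anti(X)` irreducible, so
  `P = Anti(X)`; then F1); **`exists_equivariant_equiv_of_ne_bot'`** — the same from a non-zero stable `P ≤ U(Φ_Y)` with an
  equivariant `T'` injective on `P` and `T'(P) ≤ U(Φ_X)` (`T'(P)` is non-zero stable in the irreducible `U(Φ_X)`, so it is
  `Anti(X)`, and the inverse `S` of §1 is as in F1).  Contrapositive packaging **`pairwise_of_forall_not_equivariant`**: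
  if NO bijection `X ≃ Y` is `G`-equivariant, the two slots have no common constituent in either order — the `hpair`
  hypothesis of the pairwise criterion, for this pair.

For CM fields (sequel `PairFlipCompanionCMFieldsHodge`): `Hom(K₀, ℂ) ≃ Hom(K₁, ℂ)` equivariantly forces `K₀ ≅ K₁`, so a
pair-flip field `K₀` and a NON-ISOMORPHIC `K₁` of the same degree whose pairs the flips preserve never share a
constituent.

## References

* [Gordon1999HodgeAVSurvey] B. B. Gordon, *A survey of the Hodge conjecture for abelian varieties*, §3 Theorem (Imai,
  Murty) with proof, 7.5–7.7.
* [Serre1977] J.-P. Serre, *Linear Representations of Finite Groups*, GTM 42, §1.3 Thm. 1, §2.2 (Schur).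
* [Dodson1984] B. Dodson, *The structure of Galois groups of CM-fields*, Trans. AMS 283 (1984), §1.1, §5.1.2.
-/

set_option autoImplicit false

open scoped BigOperators

namespace Summit.HodgeConjecture.CorCM

namespace PairFlipTransport

open Literature.NumberTheory.ComplexMultiplication

variable {G : Type*} [Group G] {X Y : Type*} [MulAction G X] [MulAction G Y] {ρ : G}

/-! ### §1 Inverting an equivariant injection on its image -/

omit [MulAction G X] in
/-- The image `T'(P)` of a stable `P` under a map equivariant on `P` is stable. [cite: Serre1977, §1.3] -/
theorem comp_smul_mem_map (P : Submodule ℚ (Y → ℚ)) (hst : ∀ g : G, ∀ f ∈ P, (fun y => f (g • y)) ∈ P)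
    [MulAction G X] (T' : (Y → ℚ) →ₗ[ℚ] (X → ℚ))
    (hTeq : ∀ g : G, ∀ f ∈ P, T' (fun y => f (g • y)) = fun x => T' f (g • x))
    (g : G) {f : X → ℚ} (hf : f ∈ P.map T') : (fun x => f (g • x)) ∈ P.map T' := by
  obtain ⟨p, hp, rfl⟩ := Submodule.mem_map.1 hf
  exact Submodule.mem_map.2 ⟨fun y => p (g • y), hst g p hp, hTeq g p hp⟩

/-- **An equivariant injection on a stable subspace has an equivariant inverse on its image.**  For `P ≤ ℚ^Y` stable and
`T' : ℚ^Y → ℚ^X` linear, equivariant and injective on `P`, there is a linear `S : ℚ^X → ℚ^Y` with values in `P`, with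
`S(T' p) = p` on `P` and `T'(S f) = f` on `T'(P)`, equivariant and injective on `T'(P)`.  (`S` = the inverse of
`T'|_P` after a projection onto `T'(P)` — the orthogonal one for the invariant dot product.)
[cite: Serre1977, §1.3 Thm. 1 (proof) and §2.2] -/
theorem exists_inverse_on_map [Fintype X] (P : Submodule ℚ (Y → ℚ))
    (hst : ∀ g : G, ∀ f ∈ P, (fun y => f (g • y)) ∈ P) (T' : (Y → ℚ) →ₗ[ℚ] (X → ℚ))
    (hTeq : ∀ g : G, ∀ f ∈ P, T' (fun y => f (g • y)) = fun x => T' f (g • x))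
    (hTinj : ∀ f ∈ P, T' f = 0 → f = 0) :
    ∃ S : (X → ℚ) →ₗ[ℚ] (Y → ℚ), (∀ f, S f ∈ P) ∧ (∀ p ∈ P, S (T' p) = p) ∧ (∀ f ∈ P.map T', T' (S f) = f) ∧
      (∀ g : G, ∀ f ∈ P.map T', S (fun x => f (g • x)) = fun y => S f (g • y)) ∧
      ∀ f ∈ P.map T', S f = 0 → f = 0 := by
  -- the injective map `i = T' ∘ incl_P : P → ℚ^X` with range `T'(P)`
  set i : P →ₗ[ℚ] (X → ℚ) := T' ∘ₗ P.subtype with hi_def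
  have hi : Function.Injective i := by
    intro p q hpq
    have h1 : T' ((p : Y → ℚ) - q) = 0 := by
      rw [map_sub, sub_eq_zero]; exact hpq
    exact Subtype.ext (sub_eq_zero.1 (hTinj _ (P.sub_mem p.2 q.2) h1))
  have hrange : LinearMap.range i = P.map T' := by
    rw [hi_def, LinearMap.range_comp, Submodule.range_subtype]
  -- a projection onto the stable `T'(P)`
  obtain ⟨π, hπmem, hπid, -⟩ := PointwiseConj.exists_equivariant_proj (G := G) (P.map T')
    (fun g f hf => comp_smul_mem_map P hst T' hTeq g hf)
  have hπr : ∀ f, π f ∈ LinearMap.range i := fun f => by rw [hrange]; exact hπmem f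
  set R : (X → ℚ) →ₗ[ℚ] P := LinearMap.codRestrictOfInjective π i hi hπr with hR_def
  have hR : ∀ f, T' ((R f : P) : Y → ℚ) = π f := fun f =>
    LinearMap.codRestrictOfInjective_comp_apply π i hi hπr f
  refine ⟨P.subtype ∘ₗ R, fun f => (R f).2, fun p hp => ?_, fun f hf => ?_, fun g f hf => ?_, fun f hf h0 => ?_⟩
  · -- `S (T' p) = p`: both lie in `P` and have the same image under `T'`
    have h1 : T' ((R (T' p) : P) : Y → ℚ) = T' p := by
      rw [hR, hπid _ (Submodule.mem_map_of_mem hp)]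
    have h2 : T' (((R (T' p) : P) : Y → ℚ) - p) = 0 := by rw [map_sub, h1, sub_self]
    have h3 := hTinj _ (P.sub_mem (R (T' p)).2 hp) h2
    rw [LinearMap.comp_apply, Submodule.subtype_apply]
    exact sub_eq_zero.1 h3
  · rw [LinearMap.comp_apply, Submodule.subtype_apply, hR, hπid f hf]
  · -- equivariance on `T'(P)`: write `f = T' p`
    obtain ⟨p, hp, rfl⟩ := Submodule.mem_map.1 hf
    have hSp : (P.subtype ∘ₗ R) (T' p) = p := by
      have h1 : T' ((R (T' p) : P) : Y → ℚ) = T' p := by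
        rw [hR, hπid _ (Submodule.mem_map_of_mem hp)]
      have h2 : T' (((R (T' p) : P) : Y → ℚ) - p) = 0 := by rw [map_sub, h1, sub_self]
      have h3 := hTinj _ (P.sub_mem (R (T' p)).2 hp) h2
      rw [LinearMap.comp_apply, Submodule.subtype_apply]
      exact sub_eq_zero.1 h3
    have hpg : (fun y => p (g • y)) ∈ P := hst g p hp
    have hSpg : (P.subtype ∘ₗ R) (T' fun y => p (g • y)) = fun y => p (g • y) := by
      have h1 : T' ((R (T' fun y => p (g • y)) : P) : Y → ℚ) = T' (fun y => p (g • y)) := by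
        rw [hR, hπid _ (Submodule.mem_map_of_mem hpg)]
      have h2 : T' (((R (T' fun y => p (g • y)) : P) : Y → ℚ) - fun y => p (g • y)) = 0 := by
        rw [map_sub, h1, sub_self]
      have h3 := hTinj _ (P.sub_mem (R (T' fun y => p (g • y))).2 hpg) h2
      rw [LinearMap.comp_apply, Submodule.subtype_apply]
      exact sub_eq_zero.1 h3
    rw [← hTeq g p hp, hSpg, hSp]
  · obtain ⟨p, hp, rfl⟩ := Submodule.mem_map.1 hf
    have h1 : T' ((R (T' p) : P) : Y → ℚ) = T' p := by
      rw [hR, hπid _ (Submodule.mem_map_of_mem hp)]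
    rw [LinearMap.comp_apply, Submodule.subtype_apply] at h0
    rw [← h1, h0, map_zero]

/-! ### §2 Both orders of the pairwise criterion against a compatible pair-flip slot -/

section PairFlip

variable [Fintype X] [Fintype Y] [DecidableEq X] [DecidableEq Y] {ΦX : Set X} {ΦY : Set Y}

/-- **Order `X → Y`.**  `X` transitive with pair flips compatible with `Y`, `|X| = |Y|`, `Φ_X`, `Φ_Y` CM types for `ρ`:
a NON-ZERO stable `P ≤ U(Φ_X)` with an equivariant `T`, injective on `P`, `T(P) ≤ U(Φ_Y)`, yields a `G`-equivariant
bijection `X ≃ Y` (`P = U(Φ_X) = Anti(X)` by irreducibility, then `PairFlipTransport.exists_equivariant_equiv`).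
[cite: Gordon1999HodgeAVSurvey, §3 Theorem (proof) and 7.5–7.7] [cite: Dodson1984, §5.1.2] -/
theorem exists_equivariant_equiv_of_ne_bot [MulAction.IsPretransitive G X] [Nonempty X] (hX : IsCMTypeWith ρ ΦX)
    (hY : IsCMTypeWith ρ ΦY)
    (hflip : ∀ x : X, ∃ φ : G, φ • x = ρ • x ∧ (∀ x' : X, x' ≠ x → x' ≠ ρ • x → φ • x' = x') ∧
      ∀ y : Y, φ • y = y ∨ φ • y = ρ • y)
    (hcard : Fintype.card X = Fintype.card Y) {P : Submodule ℚ (X → ℚ)} (hP : P ≤ antiSpan G ΦX) (hP0 : P ≠ ⊥)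
    (hst : ∀ g : G, ∀ f ∈ P, (fun x => f (g • x)) ∈ P) (T : (X → ℚ) →ₗ[ℚ] (Y → ℚ))
    (hTeq : ∀ g : G, ∀ f ∈ P, T (fun x => f (g • x)) = fun y => T f (g • y))
    (hTmem : ∀ f ∈ P, T f ∈ antiSpan G ΦY) (hTinj : ∀ f ∈ P, T f = 0 → f = 0) :
    ∃ γ : X ≃ Y, ∀ (g : G) (x : X), γ (g • x) = g • γ x := by
  have hflip' : ∀ x : X, ∃ φ : G, φ • x = ρ • x ∧ ∀ x' : X, x' ≠ x → x' ≠ ρ • x → φ • x' = x' :=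
    fun x => (hflip x).imp fun φ h => ⟨h.1, h.2.1⟩
  -- `P = U(Φ_X) = Anti(X)`
  have hPU : P = antiSpan G ΦX := antiSpan_irreducible_of_pairFlip hX hflip' P hP hP0 (fun k f hf => hst k f hf)
  have hUA : antiSpan G ΦX = antiWeights (E := X) ρ := antiSpan_eq_antiWeights_of_pairFlip hX hflip'
  rw [hUA] at hPU
  subst hPU
  have hAY : antiSpan G ΦY ≤ antiWeights (E := Y) ρ := antiSpan_le_antiWeights' hY
  obtain ⟨γ, hγ, -⟩ := exists_equivariant_equiv hX.invol hX.comm hX.rho_smul_ne hY.invol hY.comm hY.rho_smul_ne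
    hflip T hTeq (fun f hf => hAY (hTmem f hf)) hTinj hcard
  exact ⟨γ, hγ⟩

/-- **Order `Y → X`.**  Same slots; a NON-ZERO stable `P ≤ U(Φ_Y)` with an equivariant `T'`, injective on `P`,
`T'(P) ≤ U(Φ_X)`, again yields a `G`-equivariant bijection `X ≃ Y`: `T'(P)` is a non-zero stable subspace of the
irreducible `U(Φ_X) = Anti(X)`, hence all of it, and the inverse of `T'` on it (§1) is an equivariant injection
`Anti(X) → P ≤ Anti(Y)` to which F1 applies. [cite: Gordon1999HodgeAVSurvey, §3 Theorem (proof) and 7.5–7.7]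
[cite: Serre1977, §2.2] -/
theorem exists_equivariant_equiv_of_ne_bot' [MulAction.IsPretransitive G X] [Nonempty X] (hX : IsCMTypeWith ρ ΦX)
    (hY : IsCMTypeWith ρ ΦY)
    (hflip : ∀ x : X, ∃ φ : G, φ • x = ρ • x ∧ (∀ x' : X, x' ≠ x → x' ≠ ρ • x → φ • x' = x') ∧
      ∀ y : Y, φ • y = y ∨ φ • y = ρ • y)
    (hcard : Fintype.card X = Fintype.card Y) {P : Submodule ℚ (Y → ℚ)} (hP : P ≤ antiSpan G ΦY) (hP0 : P ≠ ⊥)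
    (hst : ∀ g : G, ∀ f ∈ P, (fun y => f (g • y)) ∈ P) (T' : (Y → ℚ) →ₗ[ℚ] (X → ℚ))
    (hTeq : ∀ g : G, ∀ f ∈ P, T' (fun y => f (g • y)) = fun x => T' f (g • x))
    (hTmem : ∀ f ∈ P, T' f ∈ antiSpan G ΦX) (hTinj : ∀ f ∈ P, T' f = 0 → f = 0) :
    ∃ γ : X ≃ Y, ∀ (g : G) (x : X), γ (g • x) = g • γ x := by
  have hflip' : ∀ x : X, ∃ φ : G, φ • x = ρ • x ∧ ∀ x' : X, x' ≠ x → x' ≠ ρ • x → φ • x' = x' :=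
    fun x => (hflip x).imp fun φ h => ⟨h.1, h.2.1⟩
  -- `Q = T'(P)` is a non-zero stable subspace of `U(Φ_X)`, hence `= U(Φ_X) = Anti(X)`
  have hQle : P.map T' ≤ antiSpan G ΦX := Submodule.map_le_iff_le_comap.2 fun f hf => hTmem f hf
  have hQ0 : P.map T' ≠ ⊥ := by
    obtain ⟨f, hfP, hf0⟩ := (Submodule.ne_bot_iff P).1 hP0
    rw [Submodule.ne_bot_iff]
    exact ⟨T' f, Submodule.mem_map_of_mem hfP, fun h => hf0 (hTinj f hfP h)⟩
  have hQst : ∀ (k : G) (f : X → ℚ), f ∈ P.map T' → (fun x => f (k • x)) ∈ P.map T' :=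
    fun k f hf => comp_smul_mem_map P hst T' hTeq k hf
  have hQU : P.map T' = antiSpan G ΦX := antiSpan_irreducible_of_pairFlip hX hflip' _ hQle hQ0 hQst
  have hUA : antiSpan G ΦX = antiWeights (E := X) ρ := antiSpan_eq_antiWeights_of_pairFlip hX hflip'
  have hAY : antiSpan G ΦY ≤ antiWeights (E := Y) ρ := antiSpan_le_antiWeights' hY
  -- the inverse `S` of `T'` on `Q = Anti(X)`
  obtain ⟨S, hSP, -, -, hSeq, hSinj⟩ := exists_inverse_on_map (G := G) P hst T' hTeq hTinj
  rw [hQU, hUA] at hSeq hSinj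
  obtain ⟨γ, hγ, -⟩ := exists_equivariant_equiv hX.invol hX.comm hX.rho_smul_ne hY.invol hY.comm hY.rho_smul_ne
    hflip S hSeq (fun f _ => hAY (hP (hSP f))) hSinj hcard
  exact ⟨γ, hγ⟩

/-- **No equivariant bijection ⟹ no common constituent, both orders.**  If no bijection `X ≃ Y` is `G`-equivariant
(for CM fields: `K₀ ≇ K₁`), then every stable `P ≤ U(Φ_X)` with an equivariant injection into `U(Φ_Y)` is zero, and
every stable `P ≤ U(Φ_Y)` with an equivariant injection into `U(Φ_X)` is zero — the two `hpair` clauses of the tree's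
pairwise criterion (`map_slotExt_antiSpan_le_of_pairwise`) for this pair of slots.
[cite: Gordon1999HodgeAVSurvey, §3 Theorem and 7.5–7.7] [cite: Dodson1984, §5.1.2] -/
theorem pairwise_of_forall_not_equivariant [MulAction.IsPretransitive G X] [Nonempty X] (hX : IsCMTypeWith ρ ΦX)
    (hY : IsCMTypeWith ρ ΦY)
    (hflip : ∀ x : X, ∃ φ : G, φ • x = ρ • x ∧ (∀ x' : X, x' ≠ x → x' ≠ ρ • x → φ • x' = x') ∧
      ∀ y : Y, φ • y = y ∨ φ • y = ρ • y)
    (hcard : Fintype.card X = Fintype.card Y) (hne : ∀ γ : X ≃ Y, ¬ ∀ (g : G) (x : X), γ (g • x) = g • γ x) :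
    (∀ P : Submodule ℚ (X → ℚ), P ≤ antiSpan G ΦX → (∀ g : G, ∀ f ∈ P, (fun x => f (g • x)) ∈ P) →
      ∀ T : (X → ℚ) →ₗ[ℚ] (Y → ℚ), (∀ g : G, ∀ f ∈ P, T (fun x => f (g • x)) = fun y => T f (g • y)) →
        (∀ f ∈ P, T f ∈ antiSpan G ΦY) → (∀ f ∈ P, T f = 0 → f = 0) → P = ⊥) ∧
    (∀ P : Submodule ℚ (Y → ℚ), P ≤ antiSpan G ΦY → (∀ g : G, ∀ f ∈ P, (fun y => f (g • y)) ∈ P) →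
      ∀ T' : (Y → ℚ) →ₗ[ℚ] (X → ℚ), (∀ g : G, ∀ f ∈ P, T' (fun y => f (g • y)) = fun x => T' f (g • x)) →
        (∀ f ∈ P, T' f ∈ antiSpan G ΦX) → (∀ f ∈ P, T' f = 0 → f = 0) → P = ⊥) := by
  refine ⟨fun P hP hst T hTeq hTmem hTinj => ?_, fun P hP hst T' hTeq hTmem hTinj => ?_⟩
  · by_contra hP0
    obtain ⟨γ, hγ⟩ := exists_equivariant_equiv_of_ne_bot hX hY hflip hcard hP hP0 hst T hTeq hTmem hTinj
    exact hne γ hγ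
  · by_contra hP0
    obtain ⟨γ, hγ⟩ := exists_equivariant_equiv_of_ne_bot' hX hY hflip hcard hP hP0 hst T' hTeq hTmem hTinj
    exact hne γ hγ

end PairFlip

end PairFlipTransport

end Summit.HodgeConjecture.CorCM
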